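import Mathlib
import HarnessLib
import Literature.MathematicalPhysics.QuantumLattice.KohnLuttinger
import Summits.HubbardSuperconductivity.HubbardSuperconductivity.Theorems.WeakCouplingBCSKlDualOrderFillingD030Upper
import Summits.HubbardSuperconductivity.HubbardSuperconductivity.Theorems.WeakCouplingBCSKlDualOrderFillingD030Lower
import Summits.HubbardSuperconductivity.HubbardSuperconductivity.Theorems.WeakCouplingBCSWcbcsKohnLuttingerB1gMuWindow

/-!
# Route `WeakCouplingBCS` / `KLProgramme` — the μ-BRACKET of `δ = 0.30` at `t' = 0`: `μ(1 − 3/10) ∈ [−29/40, −287/400]`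
# (HQ1 (ii) second dual-ordered pair of the `B1g` Kohn–Luttinger rival margin; cell `gate-hubbard-kl`, seat hubbard-klscan-idea-3 r19)

The free-band chemical potential `μ(δ) = chemicalPotentialOfDensity (squareDispersion 1 0) (1 − δ)` at hole doping `δ = 3/10` lies in
`[−0.725, −0.7175]` (inside the union `[−0.7251, −0.7174]` of the three route-P cells `m0.72510-0.72240`, `m0.72260-0.71990`, `m0.72010-0.71740`
of the cert-2 `winXY` tables; true value `−0.72107`), from the two kernel-certified filling bounds `muDualD030_filling_lt : n(−29/40) < 7/10`
(`…KlDualOrderFillingD030Upper`, circumscribed 80-trapezoid certificate) and `muDualD030_filling_ge : 7/10 ≤ n(−287/400)`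
(`…KlDualOrderFillingD030Lower`, inscribed 121-gon) through the tree's `chemicalPotentialOfDensity_window`.  Same template as the landed
`WeakCouplingBCSKlDualOrderBracketD035.lean` (r18).  Folklore; no definitions.
A Kohn–Luttinger `O(U²)` channel statement is not ODLRO; nothing here proves superconductivity in the Hubbard model.
-/



noncomputable section

set_option linter.dupNamespace false

namespace Summit.HubbardSuperconductivity.HubbardSuperconductivity.Theorems

open Literature.MathematicalPhysics.QuantumLattice

/-- **`μ(0.30) ∈ [-29/40, -287/400] = [-0.725, -0.7175]`**: the free-band chemical potential of the hole doping `δ = 3/10`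
(true value `-0.72107`), from `muDualD030_filling_lt : n(-0.725) < 7/10` and `muDualD030_filling_ge : 7/10 ≤ n(-0.7175)` through
`chemicalPotentialOfDensity_window`. [folklore] -/
theorem muOfDoping_d030_mem_Icc :
    chemicalPotentialOfDensity (squareDispersion 1 0) (1 - 3 / 10) ∈ Set.Icc (-(29 : ℝ) / 40) (-(287 : ℝ) / 400) := by
  obtain ⟨-, -, -, H⟩ := chemicalPotentialOfDensity_window (μ₁ := (-(287 : ℝ) / 400)) (μ₂ := (-(29 : ℝ) / 40))
    (by norm_num) (by norm_num) (by norm_num)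
  have hlo := muDualD030_filling_ge
  have hhi := muDualD030_filling_lt
  refine H (3 / 10) ⟨?_, ?_⟩
  · linarith
  · linarith

/-- The same bracket with `ℚ`-cast ends, the shape consumed by the `KlDualOrder` order theorems. [folklore] -/
theorem muOfDoping_d030_mem_Icc_cast :
    chemicalPotentialOfDensity (squareDispersion 1 0) (1 - 3 / 10) ∈
      Set.Icc ((((-29 : ℚ) / 40 : ℚ)) : ℝ) ((((-287 : ℚ) / 400 : ℚ)) : ℝ) := by
  obtain ⟨h₁, h₂⟩ := muOfDoping_d030_mem_Icc
  exact ⟨by push_cast; linarith, by push_cast; linarith⟩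

end Summit.HubbardSuperconductivity.HubbardSuperconductivity.Theorems

end
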